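import Literature.NumberTheory.Automorphic.Liu2021.Thm418InvariantsAsPrinted
import Literature.RepresentationTheory.Liu2021.LocalOscillatorRepresentation
import Literature.NumberTheory.Automorphic.RestrictedTensorProductIrreducibleProofs
import HarnessLib

/-!
# [Liu2021] Def. 4.11 (`ω(μ,ε,χ) := ⊗'_v ω(μ_v,ε_v,χ_v)`) + App. D Lem. D.1 (1) ⟹ `ω(μ,ε,χ) ≠ 0` for `n ≥ 3` — by name

Reproduction (Literature): kernel-checked consequences, over the datum `D : Thm418Data F E` of the statement-exact record
`Thm418AsPrinted` ([Liu2021] Thm. 4.18), of TWO printed sentences that the tree already holds: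

* [Liu2021] **Def. 4.11**, l. 2092–2096 of the author's TeX `FJcycle.tex` (arXiv:2102.11518 v2, md5 `6db49a74122d`):
  «For an adèlic oscillator triple `(μ, ε, χ)`, the local oscillator representation `ω(μ_v, ε_v, χ_v)` of `𝔾(F_v)`
  introduced in Subsection D.1 is unramified for all but finitely many `v`. Thus, it makes sense to define the *adèlic
  oscillator representation* attached to `(μ, ε, χ)`, `ω(μ, ε, χ) := ⊗'_v ω(μ_v, ε_v, χ_v)`, which is an irreducible
  admissible representation of `𝔾(𝔸_F^∞)`.» — the tree's record of the PREDICATED part is `Def411AsPrinted`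
  (`Def411AsPrinted.lean`, READING I1: «irreducible» allows the zero space); the DEFINING part «`:= ⊗'_v …`» is the
  CONSTRUCTION of the carrier `D.omega ε χ` and is therefore a datum the consumer presents: here, literally, a
  restricted tensor product in the tree's sense (`Literature.NumberTheory.Automorphic.IsRestrictedTensorProduct`,
  `RestrictedTensorProduct.lean`, Flath 1979 §2) of the local spaces.
* [Liu2021] **App. D, Lem. D.1**, l. 5226–5229 (TeX label `le:weil_nonarch`): «Suppose that `F` is nonarchimedean. Then
  `ω(μ,ε,χ)` is irreducible and admissible. Moreover, (1) `ω(μ,ε,χ)` is zero if and only if `E` is a field, `V` is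
  anisotropic (in particular `n = 2`), and `χ̌ = μ²`.» — the tree's LANDED record of the first sentence + (1) is
  `Literature.RepresentationTheory.Liu2021.LocalOscillatorDatum.IrreducibleAdmissible`
  (`Literature/RepresentationTheory/Liu2021/LocalOscillatorRepresentation.lean`), whose third clause
  `D.rank ≠ 2 → Nontrivial W` is the contrapositive of (1)'s «zero ⇒ … (in particular `n = 2`)».

WHY.  The stage-2 junctions of the Hodge/CM programme (`Transposition/Item6SupplyPinned.lean`, `Item6PinMatch.lean`,
pin-3's assembly) carry a binder `hirr : ∀ … i, ((D …).rhoAt i).IsIrreducible` tagged «VERBATIM Def. 4.11».  Mathlib's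
`Representation.IsIrreducible` (`IsSimpleOrder` of the subrepresentation lattice) CONTAINS `ω(μ,ε,χ) ≠ 0`, which Def. 4.11
as printed does not assert (red-team finding AUDIT-CITESCOPE D6.3, 2026-08-21): the non-vanishing is App. D Lem. D.1 (1)
at `n ≥ 3` — every local factor is non-zero — followed by the step «a restricted tensor product of non-zero spaces is
non-zero».  This file proves that step and packages the chain, so that `hirr`, the non-vanishing input `hnv` of
`Thm418InvariantsAsPrinted`, and the conclusion `Hom_E(A_K, A_μ)_ℚ ≠ 0` are DERIVED BY NAME from: Thm. 4.18 as printed +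
Prop. 4.6 (1) as printed + Def. 4.11 as printed (adjectives: `Def411AsPrinted`; construction: a `⊗'` presentation of the
carrier) + Lem. D.1 (1) (the landed local record at every finite place) + `3 ≤ n`.  Nothing is re-tagged; no new
record, no definition, no axiom.

* `IsRestrictedTensorProduct.nontrivial` — if `(W, j)` is a restricted tensor product `⊗'_{v} (V_v, x₀_v)` with
  exceptional set `S₀` (tree predicate: the finite levels `⨂_{v ∈ S} V_v → W` are injective for `S ⊇ S₀` and exhaust
  `W`) and `V_v ≠ 0` for `v ∈ S₀`, then `W ≠ 0` (the level `S₀` is a finite tensor product of non-zero vector spaces,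
  non-zero by `piTensorProduct_nontrivial`, and injects into `W`).
* `Thm418Data.nontrivial_omega_of_localOscillator` — for the carrier `ω(μ,ε,χ) = D.omega ε χ` PRESENTED as a restricted
  tensor product `j : RestrictedFamily Wl x₀ → D.omega ε χ` of the spaces `Wl v` of local data
  `Dloc v : LocalOscillatorDatum (Gl v) (Zl v) (Vl v) (Wl v)` ([Liu2021] App. D §D.1 Steps 1–3 at the finite place `v`:
  `Wl v` carries `ω(μ_v, ε_v, χ_v) = (Dloc v).quot`), each satisfying the Lem. D.1 record with `rank = D.n`, and
  `3 ≤ D.n`: the space `ω(μ,ε,χ)` is non-trivial.  `…_of_rank_ne_two` — the same with the sharper printed exception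
  `rank ≠ 2` at each place of `S₀` only.
* `Thm418Data.isIrreducible_rhoAt_of_localOscillator` — EXACTLY the junction binder `hirr` at an index `i`, DERIVED:
  `Def411AsPrinted D` (irreducible-or-zero, smooth, admissible — as printed) + the local presentation above ⟹
  `(D.rhoAt i).IsIrreducible` (via `Thm418Data.isIrreducible_rhoAt` of `Def411AsPrinted.lean`).
* `Thm418Data.exists_obj_homK_ne_zero_of_asPrinted_of_localOscillator` (+ `_le_` below a prescribed open compact `K′`,
  + `exists_homK_ne_zero_le_of_def411_of_localOscillator` for a prescribed object `D_μ`) — the whole supply-side chain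
  BY NAME: `Thm418AsPrinted D` + `Prop46_1AsPrinted D 𝒜` + `Def411AsPrinted D` + one `μ`-admissible index `i` whose
  `ω_i` is so presented ⟹ `∃ D_μ K₀, ∀ open compact K ≤ K₀, Hom_E(A_K, A_μ)_ℚ ∋ φ ≠ 0` (through
  `exists_obj_homK_ne_zero_of_asPrinted` of `Thm418InvariantsAsPrinted.lean`, p298169).
* `Thm418Data.localOscillator_hypotheses_consistent` — CONSISTENCY CERTIFICATE (tribunal item T5, in the kernel): over
  every CM extension `E/F` there are a datum `D` with `D.n = 3`, a morphism carrier `𝒜`, local data and a `⊗'`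
  presentation of EVERY `ω(μ,ε,χ)` at which ALL hypotheses used in this file hold simultaneously (`Thm418AsPrinted`,
  `Prop46_1AsPrinted`, `Def411AsPrinted`, the Lem. D.1 record at every place, `rank = n = 3`,
  `IsRestrictedTensorProduct`); no contradiction is derivable from any binder set below.

WHAT THE CONSUMER STILL OWES (object match, not hidden here): that its `Dloc v` ARE Liu's local oscillator data at the
finite places of `F` (module docstring §3 of `LocalOscillatorRepresentation.lean`: `F_v` non-archimedean of
characteristic `≠ 2`, `E_v` étale of rank 2, `V_v = V ⊗ E_v` hermitian of rank `n`, `(Dloc v).omega = ω(μ_v, ε_v)`,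
`(Dloc v).quot = ω(μ_v, ε_v, χ_v)`), and that `j` IS the presentation «`ω(μ,ε,χ) := ⊗'_v ω(μ_v,ε_v,χ_v)`» of Def. 4.11
(base vectors `x₀ v` = the unramified lines off a finite `S₀`).  Equivariance of `j` and the archimedean places play no
role in non-vanishing and are not assumed.  Theorems only; every declaration below is proved; axioms ⊆ {propext,
Classical.choice, Quot.sound}.

References (context; held TeX `FJcycle.tex` md5 6db49a74122d): Y. Liu, *Fourier–Jacobi cycles and arithmetic relative
trace formula*, Camb. J. Math. 9 (2021) = arXiv:2102.11518 — Def. 4.11 l. 2083–2097; Thm. 4.18 l. 2232–2245 (proof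
l. 2263: the cases `n ≥ 3` / `n = 2`); App. D §D.1 l. 5209–5224, Lem. D.1 l. 5226–5238.  D. Flath, *Decomposition of
representations into tensor products*, Proc. Sympos. Pure Math. 33 (1979) part 1, §2 (restricted tensor products).
-/

noncomputable section

open NumberField TensorProduct PiTensorProduct DirectSum CategoryTheory
open scoped RestrictedProduct

/-! ## A restricted tensor product of non-zero spaces is non-zero -/

namespace Literature.NumberTheory.Automorphic

universe u uk v w

variable {ι : Type u} {k : Type uk} [Field k] {V : ι → Type v} [∀ i, AddCommGroup (V i)] [∀ i, Module k (V i)]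
  {x₀ : ∀ i, V i} {W : Type w} [AddCommGroup W] [Module k W] [DecidableEq ι]

/-- **A restricted tensor product whose factors on the exceptional set are non-zero is non-zero.**  If `(W, j)` is a
restricted tensor product `⊗'_i (V i, x₀ i)` with exceptional finite set `S₀` (tree predicate `IsRestrictedTensorProduct`:
the finite levels `⨂_{i ∈ S} V i → W` are injective for `S ⊇ S₀`) and `V i ≠ 0` for `i ∈ S₀`, then `W ≠ 0`: the level
`S₀` is a finite tensor product of non-zero vector spaces over the field `k`, hence non-zero (`piTensorProduct_nontrivial`),
and injects into `W`.  (Off `S₀` nothing is asked: the predicate itself forces the levels through non-zero base vectors.)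
Flath 1979, §2 (the levels embed); our bookkeeping. [cite: Flath1979, §2] -/
theorem IsRestrictedTensorProduct.nontrivial {j : RestrictedFamily V x₀ → W} {S₀ : Finset ι}
    (h : IsRestrictedTensorProduct k j S₀) (hV : ∀ i ∈ S₀, Nontrivial (V i)) : Nontrivial W := by
  haveI : ∀ i : S₀, Nontrivial (V i) := fun i => hV i i.2
  haveI : Nontrivial (⨂[k] i : S₀, V i) := piTensorProduct_nontrivial
  exact (h.injective_liftFinset (Finset.Subset.refl S₀)).nontrivial

end Literature.NumberTheory.Automorphic

/-! ## Def. 4.11 (`⊗'`) + Lem. D.1 (1) at every finite place ⟹ `ω(μ, ε, χ) ≠ 0` -/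

namespace Literature.NumberTheory.Automorphic.Liu2021

namespace Thm418Data

open Literature.RepresentationTheory.Liu2021 (LocalOscillatorDatum)

universe uP uG uZ uV uW

variable {F E : Type} [Field F] [NumberField F] [IsTotallyReal F] [Field E] [NumberField E] [Algebra F E]
  [IsTotallyComplex E] [Algebra.IsQuadraticExtension F E] {D : Thm418Data F E}

variable {P : Type uP} [DecidableEq P] {Gl : P → Type uG} {Zl : P → Type uZ} [∀ v, Group (Gl v)]
  [∀ v, TopologicalSpace (Gl v)] [∀ v, CommGroup (Zl v)] {Vl : P → Type uV} {Wl : P → Type uW}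
  [∀ v, AddCommGroup (Vl v)] [∀ v, Module ℂ (Vl v)] [∀ v, AddCommGroup (Wl v)] [∀ v, Module ℂ (Wl v)]
  {x₀ : ∀ v, Wl v} {S₀ : Finset P}

/-- **`ω(μ, ε, χ) ≠ 0`, sharp form.**  Let the carrier `ω(μ,ε,χ) = D.omega ε χ` be PRESENTED as Def. 4.11 prints it,
`ω(μ,ε,χ) := ⊗'_v ω(μ_v,ε_v,χ_v)` (l. 2094): a restricted tensor product `j` of the spaces `Wl v` of local oscillator data
`Dloc v` (App. D §D.1 Steps 1–3; `Wl v` carries `(Dloc v).quot = ω(μ_v, ε_v, χ_v)`), indexed by the finite places `v`, with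
exceptional set `S₀`.  If at each `v ∈ S₀` the Lem. D.1 record holds and `rank ≠ 2` (print: «zero iff `E` is a field, `V`
is anisotropic (in particular `n = 2`), and `χ̌ = μ²`»), then `ω(μ,ε,χ)` is a non-zero space.
[cite: Liu2021, Def. 4.11 and App. D Lem. D.1 (1)] -/
theorem nontrivial_omega_of_localOscillator_of_rank_ne_two {ε : D.Eps} {χ : D.Chi}
    (Dloc : ∀ v, LocalOscillatorDatum (Gl v) (Zl v) (Vl v) (Wl v))
    (hD1 : ∀ v ∈ S₀, (Dloc v).IrreducibleAdmissible) (hn : ∀ v ∈ S₀, (Dloc v).rank ≠ 2)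
    {j : RestrictedFamily Wl x₀ → D.omega ε χ} (hj : IsRestrictedTensorProduct ℂ j S₀) :
    Nontrivial (D.omega ε χ) :=
  hj.nontrivial fun v hv => (hD1 v hv).nontrivial (hn v hv)

/-- **`ω(μ, ε, χ) ≠ 0` for `n ≥ 3`** ([Liu2021] Def. 4.11 + App. D Lem. D.1 (1); the case distinction `n ≥ 3` / `n = 2`
of the proof of Thm. 4.18, l. 2263).  The carrier `D.omega ε χ` presented as the restricted tensor product `j` of the
local spaces `Wl v` of data `Dloc v` satisfying the Lem. D.1 record AT EVERY finite place, each of rank `(Dloc v).rank =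
D.n` (the local hermitian space `V ⊗_F F_v` has the rank `n` of `𝕍`), and `3 ≤ D.n`: then `ω(μ,ε,χ)` is non-trivial.
[cite: Liu2021, Def. 4.11 and App. D Lem. D.1 (1)] -/
theorem nontrivial_omega_of_localOscillator {ε : D.Eps} {χ : D.Chi}
    (Dloc : ∀ v, LocalOscillatorDatum (Gl v) (Zl v) (Vl v) (Wl v)) (hD1 : ∀ v, (Dloc v).IrreducibleAdmissible)
    (hrank : ∀ v, (Dloc v).rank = D.n) (hn : 3 ≤ D.n)
    {j : RestrictedFamily Wl x₀ → D.omega ε χ} (hj : IsRestrictedTensorProduct ℂ j S₀) :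
    Nontrivial (D.omega ε χ) :=
  nontrivial_omega_of_localOscillator_of_rank_ne_two Dloc (fun v _ => hD1 v)
    (fun v _ => by rw [hrank v]; omega) hj

/-! ## The junction binder `hirr`, derived -/

/-- **`hirr` DERIVED** — exactly the shape of the stage-2 junctions' binder at an index `i = (ε, χ)` of Thm. 4.18's direct
sum: `Def411AsPrinted D` ([Liu2021] Def. 4.11 EXACTLY AS PRINTED: `ω_i` irreducible-or-zero, smooth, admissible) + the
`⊗'` presentation of `ω_i` by local data satisfying Lem. D.1 with `rank = D.n ≥ 3` ⟹ `ω_i` is irreducible in Mathlib's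
sense (`Representation.IsIrreducible`, which includes `ω_i ≠ 0`).  This is the binder-shape repair of the red-team
finding D6.3 with no re-tagging: «irreducible» is cited from Def. 4.11, «`≠ 0`» from Lem. D.1 (1).
[cite: Liu2021, Def. 4.11 and App. D Lem. D.1 (1)] -/
theorem isIrreducible_rhoAt_of_localOscillator (h411 : Liu2021.Def411AsPrinted D) (i : D.AdmIndex)
    (Dloc : ∀ v, LocalOscillatorDatum (Gl v) (Zl v) (Vl v) (Wl v)) (hD1 : ∀ v, (Dloc v).IrreducibleAdmissible)
    (hrank : ∀ v, (Dloc v).rank = D.n) (hn : 3 ≤ D.n)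
    {j : RestrictedFamily Wl x₀ → D.omegaAt i} (hj : IsRestrictedTensorProduct ℂ j S₀) :
    (D.rhoAt i).IsIrreducible :=
  haveI : Nontrivial (D.omegaAt i) := nontrivial_omega_of_localOscillator Dloc hD1 hrank hn hj
  isIrreducible_rhoAt h411 i

/-! ## The supply-side chain by name: Thm. 4.18 + Prop. 4.6 (1) + Def. 4.11 + Lem. D.1 (1) ⟹ `Hom_E(A_K, A_μ)_ℚ ≠ 0` -/

/-- **Thm. 4.18 + Prop. 4.6 (1) + Def. 4.11 (adjectives AND `⊗'`) + Lem. D.1 (1), all by name ⟹ for SOME object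
`D_μ ∈ 𝒜(μ)`, `Hom_E(A_K, A_μ)_ℚ ∋ φ ≠ 0` at every open compact `K` below some open compact `K₀`.**  Inputs:
`Thm418AsPrinted D`; `Prop46_1AsPrinted D 𝒜` (the object); `Def411AsPrinted D` (smoothness); one `μ`-admissible index `i`
(it exists as soon as `Chi` does, `nonempty_admIndex`) whose `ω_i` is presented as the restricted tensor product of local
data satisfying the Lem. D.1 record with `rank = D.n`; `3 ≤ D.n`.  Proof: `ω_i ≠ 0` by
`nontrivial_omega_of_localOscillator`, then `exists_obj_homK_ne_zero_of_asPrinted`.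
[cite: Liu2021, Thm. 4.18 (1), Prop. 4.6 (1), Def. 4.11 and App. D Lem. D.1 (1)] -/
theorem exists_obj_homK_ne_zero_of_asPrinted_of_localOscillator {𝒜 : SmallCategory D.Obj}
    (h : Liu2021.Thm418AsPrinted D) (h46 : Liu2021.Prop46_1AsPrinted D 𝒜) (h411 : Liu2021.Def411AsPrinted D)
    (i : D.AdmIndex) (Dloc : ∀ v, LocalOscillatorDatum (Gl v) (Zl v) (Vl v) (Wl v))
    (hD1 : ∀ v, (Dloc v).IrreducibleAdmissible) (hrank : ∀ v, (Dloc v).rank = D.n) (hn : 3 ≤ D.n)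
    {j : RestrictedFamily Wl x₀ → D.omegaAt i} (hj : IsRestrictedTensorProduct ℂ j S₀) :
    ∃ (Dμ : D.Obj) (K₀ : Subgroup D.G), IsOpenCompact K₀ ∧
      ∀ K : Subgroup D.G, IsOpenCompact K → K ≤ K₀ → ∃ φ : D.HomK K Dμ, φ ≠ 0 :=
  exists_obj_homK_ne_zero_of_asPrinted h h46 h411 ⟨i, nontrivial_omega_of_localOscillator Dloc hD1 hrank hn hj⟩

/-- The same **below a prescribed open compact `K′`** (e.g. a neat level): some object `D_μ` and some open compact
`K ≤ K′` with `Hom_E(A_K, A_μ)_ℚ ∋ φ ≠ 0`. [cite: Liu2021, Thm. 4.18 (1), Prop. 4.6 (1), Def. 4.11 and App. D Lem. D.1 (1)] -/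
theorem exists_obj_homK_ne_zero_le_of_asPrinted_of_localOscillator {𝒜 : SmallCategory D.Obj}
    (h : Liu2021.Thm418AsPrinted D) (h46 : Liu2021.Prop46_1AsPrinted D 𝒜) (h411 : Liu2021.Def411AsPrinted D)
    (i : D.AdmIndex) (Dloc : ∀ v, LocalOscillatorDatum (Gl v) (Zl v) (Vl v) (Wl v))
    (hD1 : ∀ v, (Dloc v).IrreducibleAdmissible) (hrank : ∀ v, (Dloc v).rank = D.n) (hn : 3 ≤ D.n)
    {j : RestrictedFamily Wl x₀ → D.omegaAt i} (hj : IsRestrictedTensorProduct ℂ j S₀)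
    {K' : Subgroup D.G} (hK' : IsOpenCompact K') :
    ∃ (Dμ : D.Obj) (K : Subgroup D.G), IsOpenCompact K ∧ K ≤ K' ∧ ∃ φ : D.HomK K Dμ, φ ≠ 0 :=
  exists_obj_homK_ne_zero_le_of_asPrinted h h46 h411 ⟨i, nontrivial_omega_of_localOscillator Dloc hD1 hrank hn hj⟩ hK'

/-- **A prescribed object `D_μ`, below a prescribed level** (a consumer whose pin `A_μ` is attached to a specific `D_μ`
keeps it): `Thm418AsPrinted D` + `Def411AsPrinted D` + the local presentation of one admissible `ω_i` + `3 ≤ D.n` ⟹ some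
open compact `K ≤ K′` has `Hom_E(A_K, A_μ)_ℚ ∋ φ ≠ 0`. [cite: Liu2021, Thm. 4.18 (1), Def. 4.11 and App. D Lem. D.1 (1)] -/
theorem exists_homK_ne_zero_le_of_def411_of_localOscillator (h : Liu2021.Thm418AsPrinted D)
    (h411 : Liu2021.Def411AsPrinted D) (Dμ : D.Obj) (i : D.AdmIndex)
    (Dloc : ∀ v, LocalOscillatorDatum (Gl v) (Zl v) (Vl v) (Wl v)) (hD1 : ∀ v, (Dloc v).IrreducibleAdmissible)
    (hrank : ∀ v, (Dloc v).rank = D.n) (hn : 3 ≤ D.n)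
    {j : RestrictedFamily Wl x₀ → D.omegaAt i} (hj : IsRestrictedTensorProduct ℂ j S₀)
    {K' : Subgroup D.G} (hK' : IsOpenCompact K') :
    ∃ K : Subgroup D.G, IsOpenCompact K ∧ K ≤ K' ∧ ∃ φ : D.HomK K Dμ, φ ≠ 0 :=
  haveI : Nontrivial (D.omegaAt i) := nontrivial_omega_of_localOscillator Dloc hD1 hrank hn hj
  exists_homK_ne_zero_le_of_def411 h h411 Dμ i hK'

/-! ## Consistency certificate (tribunal item T5): every hypothesis used above holds at once -/

/-- **T5 consistency certificate — the hypothesis set of this file is jointly inhabited, at `n = 3`.**  Over every CM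
extension `E/F` as in [Liu2021] l. 1878 there are: a datum `D : Thm418Data F E` with `D.n = 3` (`𝔾 := PUnit`,
`Eps := Chi := PUnit`, `Obj :=` the one-object discrete category, `μ` a weight-one conjugate symplectic character — tree
`IdeleClassGroup.exists_isConjugateSymplectic_hasCMType` —, every `ω(μ,ε,χ) := ℂ` with the trivial action, `Ω(μ) := M_μ`,
`Hom := M_μ`, `res := id`), a morphism carrier `𝒜`, ONE-PLACE local oscillator data `Dloc` (`G := Z := PUnit`,
`ω(μ_v,ε_v) := ω(μ_v,ε_v,χ_v) := ℂ` trivial, `χ_v := 1`, quotient map `id`, `rank := 3`) and, for every `(ε, χ)`, the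
presentation `j ε χ : x ↦ x(⋆)` of `ω(μ,ε,χ) = ℂ` as the restricted tensor product of the single factor `ℂ` (base vector
`1`, exceptional set `∅`), such that SIMULTANEOUSLY `Thm418AsPrinted D`, `Prop46_1AsPrinted D 𝒜`, `Def411AsPrinted D`,
`Nonempty D.Chi`, the Lem. D.1 record `(Dloc v).IrreducibleAdmissible` at every place, `(Dloc v).rank = D.n`, and
`IsRestrictedTensorProduct ℂ (j ε χ) ∅` hold.  Hence NO contradiction is derivable from any binder set of this file (each
is a sub-family, instantiated here).  A statement about hypothesis shapes, not about Liu's objects; our bookkeeping.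
[cite: Liu2021, Thm. 4.18, Prop. 4.6 (1), Def. 4.11 and App. D Lem. D.1] -/
theorem localOscillator_hypotheses_consistent (F E : Type) [Field F] [NumberField F] [IsTotallyReal F] [Field E]
    [NumberField E] [Algebra F E] [IsTotallyComplex E] [Algebra.IsQuadraticExtension F E] :
    ∃ (D : Thm418Data F E) (𝒜 : SmallCategory D.Obj)
      (Dloc : PUnit.{1} → LocalOscillatorDatum PUnit.{1} PUnit.{1} ℂ ℂ)
      (j : ∀ (ε : D.Eps) (χ : D.Chi), RestrictedFamily (fun _ : PUnit.{1} => ℂ) (fun _ => (1 : ℂ)) → D.omega ε χ),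
      Liu2021.Thm418AsPrinted D ∧ Liu2021.Prop46_1AsPrinted D 𝒜 ∧ Liu2021.Def411AsPrinted D ∧ D.n = 3 ∧
        Nonempty D.Chi ∧ (∀ v, (Dloc v).IrreducibleAdmissible) ∧ (∀ v, (Dloc v).rank = D.n) ∧
        ∀ (ε : D.Eps) (χ : D.Chi), IsRestrictedTensorProduct ℂ (j ε χ) (∅ : Finset PUnit.{1}) := by
  classical
  letI : IsCMField E := isCMField F E
  obtain ⟨μ, hμ, hw, -⟩ := IdeleClassGroup.exists_isConjugateSymplectic_hasCMType (L := E)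
    (IdeleClassGroup.cmTypeOf E (fun _ => -1) (by simp))
  -- the scalar datum of `Thm418InvariantsAsPrinted.records_consistent`, with `n := 3`
  let D : Thm418Data F E :=
    { n := 3, two_le_n := by norm_num, 𝕍 := PUnit, G := PUnit, Eps := PUnit, epsOf := fun _ => PUnit.unit,
      Chi := PUnit, μ := μ, isConjugateSymplectic := hμ, hasWeight_one := hw, Obj := Discrete PUnit,
      omega := fun _ _ => ℂ, rho := fun _ _ => 1, Ω := fieldOfValues E μ, rhoΩ := 1,
      HomK := fun _ _ => fieldOfValues E μ, res := fun _ _ => AddMonoidHom.id _ }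
  -- the one-place local datum: everything trivial on `ℂ`, rank `3`
  let Dl : LocalOscillatorDatum PUnit.{1} PUnit.{1} ℂ ℂ :=
    { omega := 1, zeta := 1, zeta_mem_center := fun z => Subgroup.mem_center_iff.2 fun g => rfl, chi := 1,
      quot := 1, proj := LinearMap.id, proj_surjective := Function.surjective_id, proj_comm := fun _ _ => rfl,
      ker_proj := by
        rw [LinearMap.ker_id]
        refine ((iSup_eq_bot).2 fun z => ?_).symm
        rw [LinearMap.range_eq_bot]
        ext
        simp,
      rank := 3, two_le_rank := by norm_num }
  -- the presentation of `ℂ` as the restricted tensor product of ONE factor `ℂ` (base vector `1`)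
  let j₀ : RestrictedFamily (fun _ : PUnit.{1} => ℂ) (fun _ => (1 : ℂ)) → ℂ := fun x => x PUnit.unit
  have hmult : IsRestrictedMultilinear ℂ j₀ :=
    { map_update_add := fun x i v w => by
        obtain rfl : i = PUnit.unit := rfl
        simp [j₀]
      map_update_smul := fun x i c v => by
        obtain rfl : i = PUnit.unit := rfl
        simp [j₀] }
  have hone : ∀ S : Finset PUnit.{1},
      (RestrictedFamily.extend (x₀ := fun _ : PUnit.{1} => (1 : ℂ)) S (fun _ : ↥S => (1 : ℂ))) PUnit.unit = 1 :=
    fun S => by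
      by_cases h : PUnit.unit ∈ S
      · rw [RestrictedFamily.extend_apply_of_mem _ _ h]
      · rw [RestrictedFamily.extend_apply_of_notMem _ _ h]
  have hsurj : ∀ S : Finset PUnit.{1}, Function.Surjective (hmult.liftFinset S) := fun S c => by
    refine ⟨c • tprod ℂ (fun _ : ↥S => (1 : ℂ)), ?_⟩
    rw [map_smul, IsRestrictedMultilinear.liftFinset_tprod]
    show c • j₀ _ = c
    simp only [j₀]
    rw [hone S, smul_eq_mul, mul_one]
  have hfin : ∀ S : Finset PUnit.{1}, Module.finrank ℂ (⨂[ℂ] _i : ↥S, ℂ) = 1 := fun S => by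
    let B := Basis.piTensorProduct (R := ℂ) (fun _ : ↥S => Module.Basis.singleton Unit ℂ)
    rw [Module.finrank_eq_card_basis B]
    simp
  have hRTP : IsRestrictedTensorProduct ℂ j₀ (∅ : Finset PUnit.{1}) := by
    refine ⟨hmult, fun S _ => ?_, ?_⟩
    · haveI : FiniteDimensional ℂ (⨂[ℂ] _i : ↥S, ℂ) :=
        Module.Finite.of_basis (Basis.piTensorProduct (R := ℂ) (fun _ : ↥S => Module.Basis.singleton Unit ℂ))
      exact (LinearMap.injective_iff_surjective_of_finrank_eq_finrank
        (by rw [hfin S, Module.finrank_self])).2 (hsurj S)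
    · exact eq_top_iff.2 fun c _ => Submodule.mem_iSup_of_mem ∅ (hsurj ∅ c)
  obtain ⟨i₀⟩ : Nonempty D.AdmIndex := nonempty_admIndex (D := D) PUnit.unit
  haveI : Subsingleton D.AdmIndex := ⟨fun a b => Subtype.ext (Subsingleton.elim (α := PUnit × PUnit) _ _)⟩
  have htop : IsOpenCompact (⊤ : Subgroup D.G) := by
    refine ⟨?_, ?_⟩ <;> rw [Subgroup.coe_top]
    · exact isOpen_univ
    · exact isCompact_univ
  refine ⟨D, (inferInstance : SmallCategory (Discrete PUnit)), fun _ => Dl, fun _ _ => j₀, ?_, ?_, ?_, rfl,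
    ⟨PUnit.unit⟩, fun _ => ?_, fun _ => rfl, fun _ _ => hRTP⟩
  · -- `Thm418AsPrinted D` at the scalar datum (as in `Thm418InvariantsAsPrinted.records_consistent`)
    let e₁ : ℂ ⊗[fieldOfValues E μ] (fieldOfValues E μ) ≃ₗ[ℂ] ℂ :=
      TensorProduct.AlgebraTensorModule.rid (fieldOfValues E μ) ℂ ℂ
    let e₂ : ℂ ≃ₗ[ℂ] (⨁ _ : D.AdmIndex, ℂ) :=
      LinearEquiv.ofLinear (DirectSum.lof ℂ D.AdmIndex (fun _ => ℂ) i₀) (DirectSum.component ℂ D.AdmIndex (fun _ => ℂ) i₀)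
        (LinearMap.ext fun y => by
          show DirectSum.lof ℂ D.AdmIndex (fun _ => ℂ) i₀ (DirectSum.component ℂ D.AdmIndex (fun _ => ℂ) i₀ y) = y
          refine DFinsupp.ext fun j => ?_
          obtain rfl : j = i₀ := Subsingleton.elim _ _
          exact DirectSum.lof_apply ℂ (M := fun _ => ℂ) j _)
        (LinearMap.ext fun c => by
          show DirectSum.component ℂ D.AdmIndex (fun _ => ℂ) i₀ (DirectSum.lof ℂ D.AdmIndex (fun _ => ℂ) i₀ c) = c
          exact DirectSum.component.lof_self ℂ (M := fun _ => ℂ) i₀ c)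
    refine ⟨e₁.trans e₂, ?_, ?_, ?_, ?_⟩
    · intro g x i
      have h1 : (D.rhoΩ g).baseChange ℂ x = x := by
        show ((1 : Representation (fieldOfValues E μ) PUnit (fieldOfValues E μ)) g).baseChange ℂ x = x
        rw [MonoidHom.one_apply, LinearMap.baseChange_one]
        rfl
      rw [h1]
      rfl
    · intro Dμ
      refine ⟨⊤, htop, fun K _ _ => ⟨fun a b h => h, ?_⟩⟩
      ext x
      exact ⟨fun _ k _ => rfl, fun _ => ⟨x, rfl⟩⟩
    · exact fun i j _ => Subsingleton.elim i j
    · intro ε _ σ x _ i hne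
      exact absurd (Subsingleton.elim _ _) hne
  · -- `Prop46_1AsPrinted D 𝒜`: one object, connected, thin
    refine ⟨⟨⟨PUnit.unit⟩⟩, ?_, ?_⟩
    · refine zigzag_isConnected fun j₁ j₂ => ?_
      obtain ⟨⟨⟩⟩ := j₁
      obtain ⟨⟨⟩⟩ := j₂
      exact Relation.ReflTransGen.refl
    · intro a b
      infer_instance
  · -- `Def411AsPrinted D`: the trivial representation on `ℂ` is irreducible-or-zero, smooth, admissible
    intro ε χ
    refine ⟨fun W => ?_, fun v => ⟨⊤, ?_, fun k _ => rfl⟩, fun K _ => ?_⟩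
    · rcases Ideal.eq_bot_or_top (W.toSubmodule : Ideal ℂ) with hW | hW
      · exact Or.inl (Subrepresentation.toSubmodule_injective hW)
      · exact Or.inr (Subrepresentation.toSubmodule_injective hW)
    · rw [Subgroup.coe_top]
      exact isOpen_univ
    · infer_instance
  · -- the Lem. D.1 record at the one-place datum: admissible; irreducible (a `ℂ`-subspace of `ℂ` is `0` or `ℂ`); non-zero
    refine ⟨⟨fun v => isOpen_discrete _, fun K _ => ?_⟩, fun _ => ?_, fun _ => inferInstance⟩
    · show Module.Finite ℂ _
      infer_instance
    · refine isIrreducible_of_nontrivial (ρ := Dl.quot) fun W => ?_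
      rcases Ideal.eq_bot_or_top (W.toSubmodule : Ideal ℂ) with hW | hW
      · exact Or.inl (Subrepresentation.toSubmodule_injective hW)
      · exact Or.inr (Subrepresentation.toSubmodule_injective hW)

end Thm418Data

end Literature.NumberTheory.Automorphic.Liu2021

end
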